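import Summits.BirchSwinnertonDyer.BirchSwinnertonDyer.Theorems.AdditiveKolyvaginRoadLevelKolyvaginSystemsAdditiveIffKolyvaginPrimitive
import HarnessLib

/-!
# Route `AdditiveKolyvaginRoad`, crux KS′ `LevelKolyvaginSystemsAdditive` (item stmt-BirchSwinnertonDyer-21396): the FRAME-WISE
# equivalence KS′-fibre ⟺ KPA′-conclusion modulo the published inputs (width seat bsd-wall-akr-p2x-w2 g6; cell `pub/bsd-wall`;
# `--supports stmt-BirchSwinnertonDyer-21396`)

WHAT. The lead's capstone `levelKolyvaginSystemsAdditive_iff_kolyvaginPrimitiveAdditive_of_published` (p629856) identifies the two cruxes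
KS′ (r8, 21396) and KPA′ (r2, 21400) as ROUTE-LEVEL statements (both quantified over all ♯ frames). This file records the finer, FRAME-WISE
form the skeleton's residual bookkeeping needs: at ONE ♯ rank-one additive frame `(E, p, K, Dt, β, ι)` with `d_K < −4`,
* §1 `exists_kolyvaginClass_ne_zero_of_nonempty_levelKolyvaginSystemP_of_published` — PUB → DUAL → (KS′'s fibre at the frame: a level system for
  every complex conjugation `c ≠ 1` and every `ZMod p`-structure) → KPA′'s conclusion at the frame (a Kolyvagin–Heegner datum of Kolyvagin-prime
  support with `c(1) ≠ 0`).  Proof = the tree's BOT′-free composition `kolyvaginPrimitiveAdditive_of_levelSystems` (akr-p1 lineage) read at one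
  frame: parity from PUB + levelwise Cassels–Tate (`oddSelmerRankAdditive_of_levelInputs`); Selmer rank `1`: the bottom is inside the level system
  (`kolyvaginPrimitive_of_levelSystem_of_rankOne`) with the two-prime jump from Poitou–Tate; Selmer rank `≥ 3`: rank lowering A1, the local package
  from Poitou–Tate and W. Zhang's induction engine (`stub_inductionOfLevelSystemsAdditive`).
* §2 `nonempty_levelKolyvaginSystemP_iff_exists_kolyvaginClass_ne_zero_of_published` — with the lead's frame-wise socket
  `nonempty_levelKolyvaginSystemP_of_kolyvaginClass_ne_zero_of_published` (p629856 §3): PUB → DUAL → (KS′-fibre ⟺ KPA′-conclusion) AT THE FRAME.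
CONSEQUENCE for the registered skeleton of 21396 (line `epsilon_matched_retyping`, v12): its residual stub (KPA′'s conclusion off the slim
good-avatar locus) is equivalent, frame by frame and modulo PUB ∕ DUAL, to the crux's own fibre there — the residual is exact frame-wise, not only
route-wise.

HONEST FRAMING: theorems only; 0 definitions, 0 named facts, 0 `sorry`; PUB and DUAL are hypotheses (published inputs, items 20137 ∕ 21333);
CONDITIONAL glue, closes nothing. BSD is not proved by any of this; KS′ ∕ KPA′ are OPEN at `p² ∣ N`.

References: [cite: WZhang2014, §9 proof of Thm. 9.1, Thm. 9.2, Thm. 4.3, Lemma 5.3, Thm. 7.2, Lemma 8.2] [cite: GrossLMS1991, §4, Prop. 2.3]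
[cite: Howard2004HeegnerKolyvagin, Lemma 2.5.3, Lemma 2.6.4] [cite: McCallumLMS1991, Cor. 3.2].
-/

-- single-conjunct summit: `Summit.BirchSwinnertonDyer.BirchSwinnertonDyer.…` repeats the name by design
set_option linter.dupNamespace false

noncomputable section

open scoped Classical

namespace Summit.BirchSwinnertonDyer.BirchSwinnertonDyer.Theorems.AdditiveKoly

open WeierstrassCurve NumberField IsDedekindDomain Field Literature.NumberTheory.EllipticCurves
  Literature.NumberTheory.EllipticCurves.ModularForms
  Literature.NumberTheory.EllipticCurves.Rank1Residual
  Literature.NumberTheory.GaloisRepresentations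
  Summit.BirchSwinnertonDyer.Rank1Residual Module
open Summit.BirchSwinnertonDyer.BirchSwinnertonDyer.Theses.AdditiveKolyvaginRoad

/-! ## §1 KS′-fibre at a frame ⟹ KPA′-conclusion at the frame (PUB, DUAL) -/

/-- **Frame-wise converse: the level systems at ONE ♯ frame give a non-zero Kolyvagin class at that frame**, granted the published inputs
`PublishedInputsAdditiveKoly` and the published duality inputs `PublishedDualityInputsAdditiveKoly`. Frame: `p ≥ 5`, `Addv`, `ρ̄` onto, ♠(1), ♠(2),
`p ∤ ∏c`, `r_an = 1`, `K` imaginary quadratic with `d_K` odd `< −4`, Heegner for `N_E`, `L(E^{d_K},1) ≠ 0`, `4N ∣ β² − d_K`, `p ∤ c(Dt)`.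
Hypothesis: `Nonempty (LevelKolyvaginSystemP W K p Dt β ι c)` for every complex conjugation `c ≠ 1` and every `ZMod p`-structure (KS′'s fibre).
Conclusion: KPA′'s fibre. The proof is the tree's `kolyvaginPrimitiveAdditive_of_levelSystems` (BOT′-free composition) read at one frame.
[cite: WZhang2014, §9 proof of Thm. 9.1, Thm. 9.2, Lemma 5.3, Thm. 7.2, Lemma 8.2] [cite: GrossLMS1991, §4, Prop. 2.3] -/
theorem exists_kolyvaginClass_ne_zero_of_nonempty_levelKolyvaginSystemP_of_published (hPUB : PublishedInputsAdditiveKoly)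
    (hDual : PublishedDualityInputsAdditiveKoly)
    (W : WeierstrassCurve ℚ) [W.IsElliptic] [W.IsGloballyMinimal] [NeZero (W.conductorNorm ℤ)]
    (p : ℕ) [Fact p.Prime] (K : Type) [Field K] [NumberField K]
    (Dt : ModularParametrizationData W (W.conductorNorm ℤ)) (β : ℤ) (ι : K →+* ℂ)
    (hp5 : 5 ≤ p) (hadd : Addv W p) (hs : W.HasSurjectiveModNGaloisRep p)
    (hsp : ∀ (ℓ : ℕ) [Fact ℓ.Prime], W.HasMultiplicativeReductionAtPrime ℓ → ¬ p ∣ padicValInt ℓ W.minimalDiscriminantInt)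
    (htwo : ∃ (ℓ₁ ℓ₂ : ℕ) (_ : Fact ℓ₁.Prime) (_ : Fact ℓ₂.Prime), ℓ₁ ≠ ℓ₂ ∧
      W.HasMultiplicativeReductionAtPrime ℓ₁ ∧ W.HasMultiplicativeReductionAtPrime ℓ₂)
    (htam : ¬ p ∣ W.tamagawaProduct) (hr : W.analyticRank = 1) (hK : IsImaginaryQuadratic K) (hodd : Odd (NumberField.discr K))
    (hlt : NumberField.discr K < -4) (hH : SatisfiesHeegnerHypothesis (W.conductorNorm ℤ) K)
    (hL : (W.quadraticTwist (NumberField.discr K : ℚ)).entireLFunction 1 ≠ 0)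
    (hβ : (4 * (W.conductorNorm ℤ : ℤ)) ∣ β ^ 2 - NumberField.discr K) (hcM : ¬ (p : ℤ) ∣ Dt.c)
    (hKSf : (∀ (c : K ≃ₐ[ℚ] K), c ≠ 1 → ∀ [Module (ZMod p) (Vp W K p)], Nonempty (LevelKolyvaginSystemP W K p Dt β ι c))) :
    (∃ (n : ℕ) (d : KolyvaginHeegnerData Dt β ι n),
      KolyvaginDescent.KolSupp (Zhang2014.IsKolyvaginPrime (W.conductorNorm ℤ) W K p) n ∧ d.kolyvaginClass (Fact.out : p.Prime) 1 ≠ 0) := by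
  have hp : p.Prime := Fact.out
  obtain ⟨s, hsodd, hsel⟩ := oddSelmerRankAdditive_of_levelInputs hPUB.1 hPUB.2.1 hPUB.2.2.2.2.1 hDual.1 W p K Dt β ι
    hp5 hadd hs hsp htwo htam hr hK hodd hH hL hβ hcM
  obtain ⟨c, hc1⟩ := exists_algEquiv_ne_one_of_isImaginaryQuadratic K hK
  -- the unique `ZMod p`-module structure on `H¹(K, E[p])`
  letI : Module (ZMod p) (Vp W K p) :=
    AddCommGroup.zmodModule (fun x ↦ by
      have h := zsmul_discreteH1_torsion ((p ^ 1 : ℕ) : ℤ) x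
      rw [← natCast_zsmul]
      convert h using 2
      push_cast
      ring)
  obtain ⟨S⟩ := hKSf c hc1
  by_cases h1 : s = 1
  · -- the bottom is inside the level system: KS′-fibre + the two-prime jump from DUAL.2
    subst h1
    rw [pow_one] at hsel
    exact kolyvaginPrimitive_of_levelSystem_of_rankOne W K p c Dt β ι hp5 hadd hs hK hH hc1
      (twoPrimeJump_of_poitouTate W K p c hp5 hK hc1 (hDual.2 K)) S hsel
  · -- Selmer rank odd and `≠ 1`, hence `≥ 3`: Zhang's induction above the bottom
    have h3 : 3 ≤ s := by
      obtain ⟨k, hk⟩ := hsodd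
      omega
    have hp2 : p ≠ 2 := by omega
    letI : ∀ v : Place K, Module (ZMod p)
        (galoisCohomology (((W.baseChange K).torsionGaloisModule ((p ^ 1 : ℕ) : ℤ)).toLocal v) 1) := fun v ↦
      AddCommGroup.zmodModule (fun x ↦ by
        have h := galoisCohomology.nsmul_eq_zero_of_forall
          (((W.baseChange K).torsionGaloisModule ((p ^ 1 : ℕ) : ℤ)).toLocal v) (n := p ^ 1)
          (fun m => AddSubgroup.torsionBy.nsmul m) x
        simpa using h)
    -- cup products need compact absolute Galois groups; `E[p](K̄)` is finite
    haveI : NeZero (p ^ 1 : ℕ) := ⟨pow_ne_zero 1 hp.ne_zero⟩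
    haveI : ∀ v : Place K, CompactSpace (absoluteGaloisGroup (Place.Completion v)) := fun v ↦
      absoluteGaloisGroup_compactSpace _
    haveI : Finite (geomTorsion (W.baseChange K) ((p ^ 1 : ℕ) : ℤ)) :=
      finite_geomTorsion_of_neZero (W.baseChange K) (p ^ 1)
    have hA1 := stub_rankLoweringAdditive W p K Dt β ι hp5 hadd hs hsp htwo htam hr hK hodd hH hL hβ hcM c hc1
    obtain ⟨L⟩ := kolyvaginLocalPackageP_of_poitouTate W K p ι c hK hp2 hlt hs hc1 (hDual.2 K)
    exact stub_inductionOfLevelSystemsAdditive W p K Dt β ι hp5 hadd hs hsp htwo htam hr hK hodd hH hL hβ hcM c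
      hc1 hA1 S L s hsodd h3 hsel

/-! ## §2 The frame-wise equivalence -/

/-- **KS′-fibre ⟺ KPA′-conclusion AT ONE ♯ FRAME, modulo PUB ∕ DUAL.** Frame as in §1 (`d_K < −4`). `→`: §1. `←`: the lead's frame-wise socket
`nonempty_levelKolyvaginSystemP_of_kolyvaginClass_ne_zero_of_published` (one non-zero Kolyvagin class seeds the level system: mixed spaces,
twin dichotomy from Poitou–Tate, odd bottom rank from PUB + Cassels–Tate). The route-level `↔` of p629856 is this statement quantified over frames.
[cite: WZhang2014, Thm. 4.3, Thm. 7.2, §8.1, §9] [cite: Howard2004HeegnerKolyvagin, Lemma 2.5.3, Lemma 2.6.4] [cite: McCallumLMS1991, Cor. 3.2] -/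
theorem nonempty_levelKolyvaginSystemP_iff_exists_kolyvaginClass_ne_zero_of_published (hPUB : PublishedInputsAdditiveKoly)
    (hDual : PublishedDualityInputsAdditiveKoly)
    (W : WeierstrassCurve ℚ) [W.IsElliptic] [W.IsGloballyMinimal] [NeZero (W.conductorNorm ℤ)]
    (p : ℕ) [Fact p.Prime] (K : Type) [Field K] [NumberField K]
    (Dt : ModularParametrizationData W (W.conductorNorm ℤ)) (β : ℤ) (ι : K →+* ℂ)
    (hp5 : 5 ≤ p) (hadd : Addv W p) (hs : W.HasSurjectiveModNGaloisRep p)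
    (hsp : ∀ (ℓ : ℕ) [Fact ℓ.Prime], W.HasMultiplicativeReductionAtPrime ℓ → ¬ p ∣ padicValInt ℓ W.minimalDiscriminantInt)
    (htwo : ∃ (ℓ₁ ℓ₂ : ℕ) (_ : Fact ℓ₁.Prime) (_ : Fact ℓ₂.Prime), ℓ₁ ≠ ℓ₂ ∧
      W.HasMultiplicativeReductionAtPrime ℓ₁ ∧ W.HasMultiplicativeReductionAtPrime ℓ₂)
    (htam : ¬ p ∣ W.tamagawaProduct) (hr : W.analyticRank = 1) (hK : IsImaginaryQuadratic K) (hodd : Odd (NumberField.discr K))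
    (hlt : NumberField.discr K < -4) (hH : SatisfiesHeegnerHypothesis (W.conductorNorm ℤ) K)
    (hL : (W.quadraticTwist (NumberField.discr K : ℚ)).entireLFunction 1 ≠ 0)
    (hβ : (4 * (W.conductorNorm ℤ : ℤ)) ∣ β ^ 2 - NumberField.discr K) (hcM : ¬ (p : ℤ) ∣ Dt.c) :
    (∀ (c : K ≃ₐ[ℚ] K), c ≠ 1 → ∀ [Module (ZMod p) (Vp W K p)], Nonempty (LevelKolyvaginSystemP W K p Dt β ι c)) ↔
    (∃ (n : ℕ) (d : KolyvaginHeegnerData Dt β ι n),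
      KolyvaginDescent.KolSupp (Zhang2014.IsKolyvaginPrime (W.conductorNorm ℤ) W K p) n ∧ d.kolyvaginClass (Fact.out : p.Prime) 1 ≠ 0) :=
  ⟨exists_kolyvaginClass_ne_zero_of_nonempty_levelKolyvaginSystemP_of_published hPUB hDual W p K Dt β ι hp5 hadd hs hsp htwo htam hr hK
      hodd hlt hH hL hβ hcM,
    nonempty_levelKolyvaginSystemP_of_kolyvaginClass_ne_zero_of_published hPUB hDual W p K Dt β ι hp5 hadd hs hsp htwo htam hr hK hodd hlt
      hH hL hβ hcM⟩

end Summit.BirchSwinnertonDyer.BirchSwinnertonDyer.Theorems.AdditiveKoly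

end
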